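import Summits.MatrixMultiplication.OmegaCensus.TorusPairBound

/-!
# ω-census (tpp lane): the TRANSVERSAL lemma and the equivalences C6″ ⟺ symmetric torus bound ⟺ `NoSlackEight` (Q6b)

Contributed by the speedrun lane `tpp` (summit MatrixMultiplication), seat `sr-tpp-search-g22` (2026-08-24; source
`run/shared/lean/speedrun/tpp/sr-tpp-search-g22/lean/TorusFiveNinthsProof.lean` v3, 914 lines, sha256
`8246c8148034ac501ead741d201aede3e556ac7f950f8d9e828748e18e85fd2b`, farm `lean check` rc 0, axioms `propext`, `Classical.choice`, `Quot.sound` only),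
split into three tree files (`TorusFiveNinthsTheorem` §§1–5, `TorusPairBound` §6, `TorusTransversalEquiv` §§7–9) and restyled by seat
`sr-tpp-search-g30` (2026-08-26: the verbatim copies of `upFace` / `ValidUp` / `FiveNinthsTorus` / `PairSatTPP` / `FiveNinthsPairBound` that made
the lane file self-contained are DROPPED — every theorem now speaks about the tree declarations of `TorusFiveNinths.lean` and
`PairWallFiveNinths.lean` directly; a docstring on every declaration; proofs unchanged).
Framing: lottery ticket; floor = certified bounds/negative ranges.  Nothing in this file is progress on `ω`; it records STRUCTURE of the small-group TPP census (lane documents `run/shared/lean/speedrun/tpp/STRUCTURE.md`, `WRITEUP-A.md`).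

CONTENT (§§7–9 of the lane file).  §7 `transversal` (converse of `TorusDensity.Proof.pair_to_torus`): from a μ₃-symmetric VALID `U ∌ 0` in
`ℤ_p` select one member per orbit that is private via its OWN base face; `B = 1 + (1−u)·Y` then satisfies `PairLaw.PairSatTPP p u 0 1 B` with
`3|B| = |U|`.  §8: hence the lane's conjecture C6″ for all `p` (`PairLaw.FiveNinthsPairBound`, `PairWallFiveNinths.lean`) is EQUIVALENT to the
symmetric torus bound `SymTorusBound` (`9|U| ≤ 5(p−1)` for symmetric valid `U ∌ 0`), which holds off the class `p ≡ 22 (mod 27)`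
(`symTorusBound_of_mod27`).  §9: on that class the only possible failure is a symmetric valid `U ∌ 0` with `9|U| = 5p − 2` (certificate slack
`20p − 36|U| = 8`), so C6″ ⟺ `NoSlackEight` (`fiveNinthsPairBound_iff_noSlackEight`) — the lane's question Q6b.  The lane holds a complete
Lean proof line of `NoSlackEight` PENDING LANDING (not here, not yet in the tree): PA-2 for `p ≥ 6400` (seats `sr-tpp-search-g25…g28`, standard
axioms) and certified SAT for the 45 primes `p ≡ 22 (mod 27)` below `6400` (seat `sr-tpp-search-g29`, `bv_decide` back end, one native-evaluation
axiom per prime).  In this file `NoSlackEight` is a `Prop` asserted nowhere.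
-/

namespace Summit.MatrixMultiplication.OmegaCensus.SpeedrunTPP.TorusDensity.Proof

open Summit.MatrixMultiplication.OmegaCensus.SpeedrunTPP.PairLaw (PairSatTPP FiveNinthsPairBound)

/-! ## 7. The transversal lemma (converse of `pair_to_torus`) and the equivalence C6″ ⟺ symmetric torus bound

From a μ₃-symmetric valid `U ∌ 0` we select one member per orbit that is private via its OWN base face; `B = 1 + (1−u)·Y`
then satisfies `PairSatTPP p u 0 1 B` with `3|B| = |U|`.  Hence g21's conjecture `FiveNinthsPairBound` (C6″, all `p`) is
EQUIVALENT to the torus statement `SymTorusBound` (`9|U| ≤ 5(p−1)` for symmetric valid `U ∌ 0`), whose only open case is the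
class `p ≡ 22 (mod 27)` (Q6b). -/
section Transversal

variable {p : ℕ}

/-- `x` is private via its OWN base face: `x ∈ U`, `x+1 ∉ U`, `x+1+u ∉ U`. -/
def BasePriv (u : ZMod p) (U : Finset (ZMod p)) (x : ZMod p) : Prop := x ∈ U ∧ x + 1 ∉ U ∧ x + 1 + u ∉ U

/-- `BasePriv u U` is a decidable predicate. -/
instance instDecBasePriv (u : ZMod p) (U : Finset (ZMod p)) : DecidablePred (BasePriv u U) := by
  intro x; unfold BasePriv; exact inferInstance

/-- the μ₃-orbit of `x` as a finset -/
def orb (u : ZMod p) (x : ZMod p) : Finset (ZMod p) := {x, u * x, u ^ 2 * x}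

open Classical in
/-- a base-private member of the finset `S`, if any (else `0`) -/
noncomputable def selS (u : ZMod p) (U : Finset (ZMod p)) (S : Finset (ZMod p)) : ZMod p :=
  if h : (S.filter (BasePriv u U)).Nonempty then h.choose else 0

/-- the selected base-private member of the orbit of `x` -/
noncomputable def sel (u : ZMod p) (U : Finset (ZMod p)) (x : ZMod p) : ZMod p := selS u U (orb u x)

section lemmas
variable {u : ZMod p} {U : Finset (ZMod p)}

/-- The orbit of `u·x` is the orbit of `x`. -/
theorem orb_mul (hu3 : u ^ 3 = 1) (x : ZMod p) : orb u (u * x) = orb u x := by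
  ext y
  have e1 : u * (u * x) = u ^ 2 * x := by ring
  have e2 : u ^ 2 * (u * x) = x := by linear_combination x * hu3
  simp only [orb, Finset.mem_insert, Finset.mem_singleton, e1, e2]
  tauto

/-- The orbit of `u²·x` is the orbit of `x`. -/
theorem orb_sq_mul (hu3 : u ^ 3 = 1) (x : ZMod p) : orb u (u ^ 2 * x) = orb u x := by
  have e : u ^ 2 * x = u * (u * x) := by ring
  rw [e, orb_mul hu3, orb_mul hu3]

/-- `sel` is constant on orbits (`u·x`). -/
theorem sel_mul (hu3 : u ^ 3 = 1) (x : ZMod p) : sel u U (u * x) = sel u U x := by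
  unfold sel; rw [orb_mul hu3]

/-- `sel` is constant on orbits (`u²·x`). -/
theorem sel_sq_mul (hu3 : u ^ 3 = 1) (x : ZMod p) : sel u U (u ^ 2 * x) = sel u U x := by
  unfold sel; rw [orb_sq_mul hu3]

/-- If the orbit of `x` has a base-private member, `sel u U x` is one. -/
theorem sel_spec {x : ZMod p} (h : ((orb u x).filter (BasePriv u U)).Nonempty) :
    sel u U x ∈ orb u x ∧ BasePriv u U (sel u U x) := by
  classical
  have : sel u U x = h.choose := by
    unfold sel selS; rw [dif_pos h]
  have hm := h.choose_spec
  rw [← this] at hm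
  simpa [Finset.mem_filter] using hm

/-- symmetry consequences -/
theorem mem_mul (hsym : ∀ x ∈ U, u * x ∈ U) {x : ZMod p} (hx : x ∈ U) : u * x ∈ U := hsym x hx

/-- `x ∈ U → u²·x ∈ U` for μ₃-symmetric `U`. -/
theorem mem_sq_mul (hsym : ∀ x ∈ U, u * x ∈ U) {x : ZMod p} (hx : x ∈ U) : u ^ 2 * x ∈ U := by
  have := hsym _ (hsym x hx); simpa [pow_two, mul_assoc] using this

/-- `x ∈ U → uˡ·x ∈ U` for μ₃-symmetric `U`. -/
theorem mem_pow_mul (hsym : ∀ x ∈ U, u * x ∈ U) {x : ZMod p} (hx : x ∈ U) (l : ℕ) : u ^ l * x ∈ U := by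
  induction l with
  | zero => simpa using hx
  | succ n ih => have := hsym _ ih; simpa [pow_succ, mul_comm, mul_assoc, mul_left_comm] using this

/-- `u·x ∈ U → x ∈ U` for μ₃-symmetric `U` (`u³ = 1`). -/
theorem mem_of_mul_mem (hu3 : u ^ 3 = 1) (hsym : ∀ x ∈ U, u * x ∈ U) {x : ZMod p} (hx : u * x ∈ U) : x ∈ U := by
  have := mem_sq_mul hsym hx
  have e : u ^ 2 * (u * x) = x := by linear_combination x * hu3
  rwa [e] at this

end lemmas

/-- **Transversal lemma.**  From a μ₃-symmetric valid `U ∌ 0` we get a pair-law set `B` with `3|B| = |U|`. -/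
theorem transversal (hp : p.Prime) (u : ZMod p) (hu3 : u ^ 3 = 1) (hu1 : u ≠ 1)
    (U : Finset (ZMod p)) (hU : ValidUp p u U) (hsym : ∀ x ∈ U, u * x ∈ U) (h0 : (0 : ZMod p) ∉ U) :
    ∃ B : Finset (ZMod p), PairSatTPP p u 0 1 B ∧ 3 * B.card = U.card := by
  classical
  haveI : Fact p.Prime := ⟨hp⟩
  -- basic field facts
  have h10 : (1 : ZMod p) ≠ 0 := one_ne_zero
  have h111 : u ^ 2 + u + 1 = 0 := by
    have hm : (u - 1) * (u ^ 2 + u + 1) = 0 := by linear_combination hu3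
    rcases mul_eq_zero.mp hm with h | h
    · exact absurd (sub_eq_zero.mp h) hu1
    · exact h
  have hu0 : u ≠ 0 := by
    intro h; rw [h] at hu3; norm_num at hu3
  have h1u : 1 + u ≠ 0 := by
    intro h
    have : u = -1 := by linear_combination h
    rw [this] at h111; norm_num at h111
  have h1mu : 1 - u ≠ 0 := by
    intro h; exact hu1 (by linear_combination -h)
  have husq1 : u ^ 2 ≠ 1 := by
    intro h
    have : u ^ 3 = u := by linear_combination u * h
    exact hu1 (by rw [this] at hu3; exact hu3)
  -- distinctness inside an orbit of a nonzero element
  have dist1 : ∀ y : ZMod p, y ≠ 0 → u * y ≠ y := by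
    intro y hy h
    have : (u - 1) * y = 0 := by linear_combination h
    rcases mul_eq_zero.mp this with h' | h'
    · exact hu1 (sub_eq_zero.mp h')
    · exact hy h'
  have dist2 : ∀ y : ZMod p, y ≠ 0 → u ^ 2 * y ≠ y := by
    intro y hy h
    have : (u ^ 2 - 1) * y = 0 := by linear_combination h
    rcases mul_eq_zero.mp this with h' | h'
    · exact husq1 (sub_eq_zero.mp h')
    · exact hy h'
  have dist12 : ∀ y : ZMod p, y ≠ 0 → u ^ 2 * y ≠ u * y := by
    intro y hy h
    have : u * ((u - 1) * y) = 0 := by linear_combination h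
    rcases mul_eq_zero.mp this with h' | h'
    · exact hu0 h'
    · rcases mul_eq_zero.mp h' with h'' | h''
      · exact hu1 (sub_eq_zero.mp h'')
      · exact hy h''
  -- Step 1: every x ∈ U has a base-private rotation
  have L1 : ∀ x ∈ U, BasePriv u U x ∨ BasePriv u U (u * x) ∨ BasePriv u U (u ^ 2 * x) := by
    intro x hx
    obtain ⟨z, hz, hface⟩ := hU x hx
    -- `w ∈ upFace z → w ∈ U → w = x`
    have only : ∀ w, w ∈ upFace p u z → w ∈ U → w = x := by
      intro w hw hwU
      have : w ∈ upFace p u z ∩ U := Finset.mem_inter.mpr ⟨hw, hwU⟩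
      rw [hface] at this; simpa using this
    have fz : z ∈ upFace p u z := by simp [upFace]
    have fz1 : z + 1 ∈ upFace p u z := by simp [upFace]
    have fz1u : z + 1 + u ∈ upFace p u z := by simp [upFace]
    simp only [Finset.mem_insert, Finset.mem_singleton] at hz
    rcases hz with rfl | rfl | rfl
    · -- z = x
      refine Or.inl ⟨hx, ?_, ?_⟩
      · intro h; have := only _ fz1 h; exact h10 (by linear_combination this)
      · intro h; have := only _ fz1u h; exact h1u (by linear_combination this)
    · -- z = x - 1 : x - 1 ∉ U, x + u ∉ U ⇒ BasePriv (u²x)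
      have n1 : x - 1 ∉ U := by
        intro h; have := only _ fz h; exact h10 (by linear_combination -this)
      have n2 : x + u ∉ U := by
        intro h
        have e : x - 1 + 1 + u = x + u := by ring
        have := only _ (e ▸ fz1u) h; exact hu0 (by linear_combination this)
      refine Or.inr (Or.inr ⟨mem_sq_mul hsym hx, ?_, ?_⟩)
      · intro h
        have h' := hsym _ h
        have e : u * (u ^ 2 * x + 1) = x + u := by linear_combination x * hu3
        rw [e] at h'; exact n2 h'
      · intro h
        have h' := hsym _ h
        have e : u * (u ^ 2 * x + 1 + u) = x - 1 := by linear_combination x * hu3 + h111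
        rw [e] at h'; exact n1 h'
    · -- z = x - 1 - u : x - 1 - u ∉ U, x - u ∉ U ⇒ BasePriv (u x)
      have n1 : x - 1 - u ∉ U := by
        intro h; have := only _ fz h; exact h1u (by linear_combination -this)
      have n2 : x - u ∉ U := by
        intro h
        have e : x - 1 - u + 1 = x - u := by ring
        have := only _ (e ▸ fz1) h; exact hu0 (by linear_combination -this)
      refine Or.inr (Or.inl ⟨hsym x hx, ?_, ?_⟩)
      · intro h
        have h' := mem_sq_mul hsym h
        have e : u ^ 2 * (u * x + 1) = x - 1 - u := by linear_combination x * hu3 + h111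
        rw [e] at h'; exact n1 h'
      · intro h
        have h' := mem_sq_mul hsym h
        have e : u ^ 2 * (u * x + 1 + u) = x - u := by linear_combination (x + 1) * hu3 + h111
        rw [e] at h'; exact n2 h'
  -- Step 2: the selection is well defined on U
  have NE : ∀ x ∈ U, ((orb u x).filter (BasePriv u U)).Nonempty := by
    intro x hx
    rcases L1 x hx with h | h | h
    · exact ⟨x, Finset.mem_filter.mpr ⟨by simp [orb], h⟩⟩
    · exact ⟨u * x, Finset.mem_filter.mpr ⟨by simp [orb], h⟩⟩
    · exact ⟨u ^ 2 * x, Finset.mem_filter.mpr ⟨by simp [orb], h⟩⟩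
  have SEL : ∀ x ∈ U, sel u U x ∈ orb u x ∧ BasePriv u U (sel u U x) := fun x hx => sel_spec (NE x hx)
  -- membership in an orbit, unfolded
  have mem_orb : ∀ x y : ZMod p, y ∈ orb u x ↔ (y = x ∨ y = u * x ∨ y = u ^ 2 * x) := by
    intro x y; simp [orb]
  -- sel y = y for y in the image
  set Y := U.image (sel u U) with hY
  have Yprop : ∀ y ∈ Y, y ∈ U ∧ BasePriv u U y ∧ sel u U y = y := by
    intro y hy
    obtain ⟨x, hx, rfl⟩ := Finset.mem_image.mp hy
    obtain ⟨horb, hbp⟩ := SEL x hx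
    refine ⟨hbp.1, hbp, ?_⟩
    rcases (mem_orb x _).mp horb with h | h | h
    · rw [h]; exact h
    · rw [h, sel_mul hu3]; exact h
    · rw [h, sel_sq_mul hu3]; exact h
  -- Step 3: fibres of sel over Y are whole orbits, of size 3
  have fiber : ∀ y ∈ Y, U.filter (fun x => sel u U x = y) = orb u y := by
    intro y hy
    obtain ⟨hyU, hbp, hsy⟩ := Yprop y hy
    ext x
    simp only [Finset.mem_filter, mem_orb]
    constructor
    · rintro ⟨hx, hsx⟩
      obtain ⟨horb, -⟩ := SEL x hx
      rw [hsx] at horb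
      rcases (mem_orb x y).mp horb with h | h | h
      · exact Or.inl h.symm
      · right; right; rw [h]; linear_combination (-x) * hu3
      · right; left; rw [h]; linear_combination (-x) * hu3
    · rintro (rfl | rfl | rfl)
      · exact ⟨hyU, hsy⟩
      · exact ⟨hsym _ hyU, by rw [sel_mul hu3, hsy]⟩
      · exact ⟨mem_sq_mul hsym hyU, by rw [sel_sq_mul hu3, hsy]⟩
  have card_orb : ∀ y ∈ Y, (orb u y).card = 3 := by
    intro y hy
    have hy0 : y ≠ 0 := by
      intro h; rw [h] at hy; exact h0 (Yprop 0 hy).1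
    have a1 : y ∉ ({u * y, u ^ 2 * y} : Finset (ZMod p)) := by
      simp only [Finset.mem_insert, Finset.mem_singleton, not_or]
      exact ⟨fun h => dist1 y hy0 h.symm, fun h => dist2 y hy0 h.symm⟩
    have a2 : u * y ∉ ({u ^ 2 * y} : Finset (ZMod p)) := by
      simp only [Finset.mem_singleton]; exact fun h => dist12 y hy0 h.symm
    unfold orb
    rw [Finset.card_insert_of_notMem a1, Finset.card_insert_of_notMem a2, Finset.card_singleton]
  have cardU : U.card = 3 * Y.card := by
    have hmap : ∀ x ∈ U, sel u U x ∈ Y := fun x hx => Finset.mem_image_of_mem _ hx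
    rw [Finset.card_eq_sum_card_fiberwise hmap]
    rw [Finset.sum_congr rfl (fun y hy => by rw [fiber y hy, card_orb y hy])]
    simp [mul_comm]
  -- Step 4: the pair-law set
  let g : ZMod p → ZMod p := fun y => 1 + (1 - u) * y
  have ginj : Function.Injective g := by
    intro y y' h
    have : (1 - u) * y = (1 - u) * y' := by simpa [g] using h
    exact mul_left_cancel₀ h1mu this
  refine ⟨Y.image g, ?_, ?_⟩
  swap
  · rw [Finset.card_image_of_injective _ ginj]; omega
  -- PairSatTPP p u 0 1 (Y.image g)
  intro k l hkl b hb b' hb' heq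
  obtain ⟨y, hy, rfl⟩ := Finset.mem_image.mp hb
  obtain ⟨y', hy', rfl⟩ := Finset.mem_image.mp hb'
  obtain ⟨hyU, hbpy, hsy⟩ := Yprop y hy
  obtain ⟨hy'U, hbpy', hsy'⟩ := Yprop y' hy'
  have core : (1 - u) * y' = (1 - u) * (u ^ (l : ℕ) * y) + (u ^ (k : ℕ) - 1) := by
    simp only [g] at heq
    linear_combination (-1 : ZMod p) * heq
  have hy0 : y ≠ 0 := fun h => h0 (h ▸ hyU)
  -- u^l * y ∈ U
  have hly : u ^ (l : ℕ) * y ∈ U := mem_pow_mul hsym hyU l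
  fin_cases k
  · -- k = 0 : y' = u^l y, l ≠ 0
    have e : y' = u ^ (l : ℕ) * y := by
      apply mul_left_cancel₀ h1mu
      simpa using core
    have hsame : sel u U y' = sel u U y := by
      fin_cases l
      · exact absurd rfl hkl
      · simp at e; rw [e, sel_mul hu3]
      · simp at e; rw [e, sel_sq_mul hu3]
    rw [hsy, hsy'] at hsame
    -- so y' = y, hence u^l y = y with l ≠ 0
    fin_cases l
    · exact absurd rfl hkl
    · simp at e; exact dist1 y hy0 (by rw [← e, hsame])
    · simp at e; exact dist2 y hy0 (by rw [← e, hsame])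
  · -- k = 1 : y' + 1 = u^l y ∈ U, contradicting BasePriv y'
    have e : y' + 1 = u ^ (l : ℕ) * y := by
      have : (1 - u) * (y' + 1) = (1 - u) * (u ^ (l : ℕ) * y) := by
        simp at core; linear_combination core
      exact mul_left_cancel₀ h1mu this
    exact hbpy'.2.1 (e ▸ hly)
  · -- k = 2 : y' + 1 + u = u^l y ∈ U, contradicting BasePriv y'
    have e : y' + 1 + u = u ^ (l : ℕ) * y := by
      have : (1 - u) * (y' + 1 + u) = (1 - u) * (u ^ (l : ℕ) * y) := by
        simp at core; linear_combination core
      exact mul_left_cancel₀ h1mu this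
    exact hbpy'.2.2 (e ▸ hly)

end Transversal

/-! ## 8. C6″ ⟺ the symmetric torus bound -/

/-- The symmetric torus bound: a μ₃-symmetric valid `U ∌ 0` has `9|U| ≤ 5(p−1)` (i.e. certificate slack `S = 20p − 36|U| ≥ 20`;
by `fiveNinthsTorus` and `S ≡ 20p (mod 108)` its only open case is `S ≠ 8` on the class `p ≡ 22 (mod 27)` — Q6b). -/
def SymTorusBound : Prop :=
  ∀ p : ℕ, p.Prime → p % 3 = 1 → ∀ u : ZMod p, u ^ 3 = 1 → u ≠ 1 →
    ∀ U : Finset (ZMod p), ValidUp p u U → (∀ x ∈ U, u * x ∈ U) → (0 : ZMod p) ∉ U → 9 * U.card ≤ 5 * (p - 1)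

/-- **C6″ (all p) ⟺ the symmetric torus bound.** -/
theorem fiveNinthsPairBound_iff_symTorusBound : FiveNinthsPairBound ↔ SymTorusBound := by
  constructor
  · intro H p hp hp3 u hu3 hu1 U hU hsym h0
    obtain ⟨B, hB, hcard⟩ := transversal hp u hu3 hu1 U hU hsym h0
    have := H p hp hp3 u hu3 hu1 0 1 B hB
    omega
  · intro H p hp hp3 u hu3 hu1 a c B hB
    obtain ⟨U, hU, hsym, h0, hcard⟩ := pair_to_torus hp u hu3 hu1 a c B hB
    have := H p hp hp3 u hu3 hu1 U hU hsym h0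
    omega

/-- Unconditionally: the symmetric torus bound with `5p` in place of `5(p−1)` (from `fiveNinthsTorus`), and hence C6″ off the class `p ≡ 22 (27)`. -/
theorem symTorusBound_of_mod27 :
    ∀ p : ℕ, p.Prime → p % 3 = 1 → p % 27 ≠ 22 → ∀ u : ZMod p, u ^ 3 = 1 → u ≠ 1 →
      ∀ U : Finset (ZMod p), ValidUp p u U → (∀ x ∈ U, u * x ∈ U) → (0 : ZMod p) ∉ U → 9 * U.card ≤ 5 * (p - 1) := by
  intro p hp hp3 hp27 u hu3 hu1 U hU hsym h0
  obtain ⟨B, hB, hcard⟩ := transversal hp u hu3 hu1 U hU hsym h0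
  have := pairBound_pm1 hp hp3 hp27 u hu3 hu1 0 1 B hB
  omega

/-! ## 9. Q6b as a named statement: `NoSlackEight`

On the class `p ≡ 22 (mod 27)` the only way `SymTorusBound` can fail is a symmetric valid `U ∌ 0` with `9|U| = 5p − 2`
(certificate slack `S = 20p − 36|U| = 8`); off the class it cannot fail at all (`symTorusBound_of_mod27`). -/

/-- **Q6b.** No μ₃-symmetric valid `U ∌ 0` on `ℤ_p`, `p ≡ 22 (mod 27)`, has `9·|U| = 5p − 2` (equivalently: certificate slack 8 is impossible). -/
def NoSlackEight : Prop :=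
  ∀ p : ℕ, p.Prime → p % 27 = 22 → ∀ u : ZMod p, u ^ 3 = 1 → u ≠ 1 →
    ∀ U : Finset (ZMod p), ValidUp p u U → (∀ x ∈ U, u * x ∈ U) → (0 : ZMod p) ∉ U → 9 * U.card ≠ 5 * p - 2

/-- **SymTorusBound ⟺ Q6b**, hence (§8) **C6″ for all p ⟺ Q6b**. -/
theorem symTorusBound_iff_noSlackEight : SymTorusBound ↔ NoSlackEight := by
  constructor
  · intro H p hp hp27 u hu3 hu1 U hU hsym h0
    have hp3 : p % 3 = 1 := by omega
    have := H p hp hp3 u hu3 hu1 U hU hsym h0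
    omega
  · intro N p hp hp3 u hu3 hu1 U hU hsym h0
    by_cases hp27 : p % 27 = 22
    · obtain ⟨B, hB, hcard⟩ := transversal hp u hu3 hu1 U hU hsym h0
      have h5 := pairBound_5p hp hp3 u hu3 hu1 0 1 B hB
      have hne := N p hp hp27 u hu3 hu1 U hU hsym h0
      omega
    · exact symTorusBound_of_mod27 p hp hp3 hp27 u hu3 hu1 U hU hsym h0

/-- **C6″ (all `p`) ⟺ Q6b `NoSlackEight`.** -/
theorem fiveNinthsPairBound_iff_noSlackEight : FiveNinthsPairBound ↔ NoSlackEight :=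
  fiveNinthsPairBound_iff_symTorusBound.trans symTorusBound_iff_noSlackEight

end Summit.MatrixMultiplication.OmegaCensus.SpeedrunTPP.TorusDensity.Proof
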